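import Mathlib
import HarnessLib

/-!
# Zhang (2022) §8 p. 47, the "simple approximation" `Z22:§8.u044`: increment moment bound
# `Σ_{Y≤n<Z} n⁻¹∏_{q∣n}(1 + c/q)·g(n) ≤ eᶜ·G·(1 + log(Z/Y))` for the weights of `S_j(𝐚₁₁,𝐚₂₁)`

Topic `Literature/NumberTheory/LFunctions/Zhang2022` (Landau–Siegel audit tree; verdict-neutral).
Y. Zhang, *Discrete mean estimates and the Landau–Siegel zero*, arXiv:2211.02515v1 (2022)
[Zhang2022LandauSiegel] — **an unrefereed manuscript under adjudication**; D-0069 campaign, cell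
`siegel-zhang`, DISCHARGE lane, node `Z22:§8.u044` ("Gathering these results together we conclude, by
simple approximation, …", tex L2436, PDF p. 47; GAP row G-d20-1). Theorem-only, elementary,
unconditional. Companion of `Section8FrontEnd44Weights` (pointwise majorant
`Σ_{dr=n}|w_j(d,r)|(1+|Π(d,r)|) ≤ 2n⁻¹∏_{q∣n}(1+106/q)`): here the MULTIPLICATIVE-INTERVAL moments of
such majorants, which control the weights of `S_j(𝐚₁₁,𝐚₂₁)` on the tail ranges `[P_k/T, P_k)` of the
"simple approximation" (`log(Z/Y) = log T = 𝓛^{1.1}`, against `log P_k ≍ 𝓛⁹` for the full range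
`[1, P_k)`, cf. the tree's full-range bound `Sec18SjNorm.sum_prod_one_add_div_le`).

* `sum_Ico_prod_one_add_div_mul_le` — for `c ≥ 0`, reals `1 ≤ Y ≤ Z` and a weight `0 ≤ g` with
  `g(n) ≤ G` for `n ≥ Y`: `Σ_{⌈Y⌉≤n<⌈Z⌉} n⁻¹∏_{q∣n}(1 + c/q)·g(n) ≤ eᶜ·G·(1 + log(Z/Y))`
  (expand `∏(1+c/q)` over the sets `T` of prime factors, sum along the multiples of `∏T` on `[Y, Z)`
  with the harmonic bound `Σ_{⌈u⌉≤m<⌈v⌉} 1/m ≤ 1 + log(v/u)`, re-fold into `∏_q(1 + c/q²) ≤ eᶜ`).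

WHAT THIS FILE IS NOT: any claim of the manuscript; nothing here bears on its Theorems 1–2 or on
Landau–Siegel zeros. No definition, no new fact.

## References

* Y. Zhang, arXiv:2211.02515v1 (2022), §8 p. 47 (tex L2436). [cite: Zhang2022LandauSiegel, §8 p.47]
-/

noncomputable section

open Real Finset

namespace Literature.NumberTheory.LFunctions.Zhang2022.Section8FrontEnd44Moments

/-! ## Harmonic sums on multiplicative intervals and the increment moment bound -/

/-- `Σ_{a ≤ m < b} 1/m ≤ 1/a + log((b−1)/a)` for `1 ≤ a < b` (`1/m ≤ log(m/(m−1))`). [folklore] -/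
private theorem sum_Ico_inv_le_aux {a : ℕ} (ha : 1 ≤ a) (k : ℕ) :
    ∑ m ∈ Finset.Ico a (a + k + 1), (m : ℝ)⁻¹ ≤ (a : ℝ)⁻¹ + Real.log (((a + k : ℕ) : ℝ) / a) := by
  have haR : (0 : ℝ) < a := by exact_mod_cast ha
  induction k with
  | zero =>
    simp only [add_zero, Finset.sum_Ico_succ_top (le_refl a), Finset.Ico_self, Finset.sum_empty,
      zero_add, div_self haR.ne', Real.log_one, add_zero, le_refl]
  | succ k ih =>
    rw [show a + (k + 1) + 1 = a + k + 1 + 1 by ring, Finset.sum_Ico_succ_top (by omega), ← add_assoc]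
    have hm : (1 : ℝ) ≤ ((a + k : ℕ) : ℝ) := by exact_mod_cast (show 1 ≤ a + k by omega)
    have hm0 : (0 : ℝ) < ((a + k : ℕ) : ℝ) := by linarith
    have hm1 : (0 : ℝ) < ((a + k + 1 : ℕ) : ℝ) := by positivity
    -- `1/(m+1) ≤ log((m+1)/m)` with `m = a + k`
    have hstep : (((a + k + 1 : ℕ) : ℝ))⁻¹ ≤
        Real.log (((a + k + 1 : ℕ) : ℝ) / a) - Real.log (((a + k : ℕ) : ℝ) / a) := by
      rw [← Real.log_div (by positivity) (by positivity), div_div_div_cancel_right₀ haR.ne']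
      have h := Real.one_sub_inv_le_log_of_pos (show 0 < ((a + k + 1 : ℕ) : ℝ) / ((a + k : ℕ) : ℝ) by
        positivity)
      rw [inv_div] at h
      have : 1 - ((a + k : ℕ) : ℝ) / ((a + k + 1 : ℕ) : ℝ) = (((a + k + 1 : ℕ) : ℝ))⁻¹ := by
        field_simp; push_cast; ring
      linarith
    push_cast at ih hstep ⊢
    linarith

/-- `Σ_{⌈u⌉ ≤ m < ⌈v⌉} 1/m ≤ 1 + log(v/u)` for reals `0 < u ≤ v`. [folklore] -/
private theorem sum_Ico_ceil_inv_le {u v : ℝ} (hu : 0 < u) (huv : u ≤ v) :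
    ∑ m ∈ Finset.Ico ⌈u⌉₊ ⌈v⌉₊, (m : ℝ)⁻¹ ≤ 1 + Real.log (v / u) := by
  have hlog : 0 ≤ Real.log (v / u) := Real.log_nonneg ((one_le_div hu).mpr huv)
  by_cases hab : ⌈u⌉₊ < ⌈v⌉₊
  · set a := ⌈u⌉₊ with ha
    have ha1 : 1 ≤ a := Nat.one_le_iff_ne_zero.mpr (Nat.ceil_pos.mpr hu).ne'
    obtain ⟨k, hk⟩ : ∃ k, ⌈v⌉₊ = a + k + 1 := ⟨⌈v⌉₊ - a - 1, by omega⟩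
    rw [hk]
    refine (sum_Ico_inv_le_aux ha1 k).trans ?_
    have haR : (1 : ℝ) ≤ a := by exact_mod_cast ha1
    have h1 : (a : ℝ)⁻¹ ≤ 1 := inv_le_one_of_one_le₀ haR
    have hv0 : 0 ≤ v := le_trans hu.le huv
    have h2 : ((a + k : ℕ) : ℝ) ≤ v := by
      have : (⌈v⌉₊ : ℝ) < v + 1 := Nat.ceil_lt_add_one hv0
      have hk' : ((a + k : ℕ) : ℝ) = (⌈v⌉₊ : ℝ) - 1 := by
        rw [hk]; push_cast; ring
      rw [hk']; linarith
    have h3 : u ≤ (a : ℝ) := by rw [ha]; exact Nat.le_ceil u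
    have hak : (0 : ℝ) < ((a + k : ℕ) : ℝ) := by
      have : (1 : ℝ) ≤ ((a + k : ℕ) : ℝ) := by exact_mod_cast (show 1 ≤ a + k by omega)
      linarith
    have h4 : Real.log (((a + k : ℕ) : ℝ) / a) ≤ Real.log (v / u) := by
      apply Real.log_le_log (by positivity)
      exact div_le_div₀ hv0 h2 hu h3
    linarith
  · rw [Finset.Ico_eq_empty hab, Finset.sum_empty]
    linarith

/-- The harmonic bound along the multiples of `d ≥ 1` on a multiplicative interval:
`Σ_{⌈Y⌉ ≤ n < ⌈Z⌉, d ∣ n} 1/n ≤ (1 + log(Z/Y))/d` (`0 < Y ≤ Z`). [folklore] -/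
private theorem sum_inv_filter_dvd_Ico_le {d : ℕ} (hd : 0 < d) {Y Z : ℝ} (hY : 0 < Y) (hYZ : Y ≤ Z) :
    ∑ n ∈ (Finset.Ico ⌈Y⌉₊ ⌈Z⌉₊).filter (fun n => d ∣ n), (n : ℝ)⁻¹ ≤ (1 + Real.log (Z / Y)) / d := by
  have hdR : (0 : ℝ) < d := by exact_mod_cast hd
  have hZ0 : 0 ≤ Z := le_trans hY.le hYZ
  have hsub : (Finset.Ico ⌈Y⌉₊ ⌈Z⌉₊).filter (fun n => d ∣ n) ⊆
      (Finset.Ico ⌈Y / d⌉₊ ⌈Z / d⌉₊).image (fun m => d * m) := by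
    intro n hn
    rw [Finset.mem_filter, Finset.mem_Ico] at hn
    obtain ⟨⟨h1, h2⟩, ⟨m, rfl⟩⟩ := hn
    rw [Finset.mem_image]
    refine ⟨m, Finset.mem_Ico.mpr ⟨?_, ?_⟩, rfl⟩
    · apply Nat.ceil_le.mpr
      rw [div_le_iff₀ hdR]
      have : Y ≤ ((d * m : ℕ) : ℝ) := le_trans (Nat.le_ceil Y) (by exact_mod_cast h1)
      push_cast at this; linarith
    · apply Nat.lt_ceil.mpr
      rw [lt_div_iff₀ hdR]
      have h3 : ((d * m : ℕ) : ℝ) ≤ (⌈Z⌉₊ : ℝ) - 1 := by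
        have : d * m + 1 ≤ ⌈Z⌉₊ := h2
        have := (Nat.cast_le (α := ℝ)).mpr this
        push_cast at this ⊢; linarith
      have h4 : (⌈Z⌉₊ : ℝ) < Z + 1 := Nat.ceil_lt_add_one hZ0
      push_cast at h3; linarith
  have hinj : Set.InjOn (fun m => d * m) ((Finset.Ico ⌈Y / d⌉₊ ⌈Z / d⌉₊ : Finset ℕ) : Set ℕ) := by
    intro a _ b _ hab
    exact Nat.eq_of_mul_eq_mul_left hd hab
  calc ∑ n ∈ (Finset.Ico ⌈Y⌉₊ ⌈Z⌉₊).filter (fun n => d ∣ n), (n : ℝ)⁻¹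
      ≤ ∑ n ∈ (Finset.Ico ⌈Y / d⌉₊ ⌈Z / d⌉₊).image (fun m => d * m), (n : ℝ)⁻¹ :=
        Finset.sum_le_sum_of_subset_of_nonneg hsub fun n _ _ => by positivity
    _ = ∑ m ∈ Finset.Ico ⌈Y / d⌉₊ ⌈Z / d⌉₊, ((d * m : ℕ) : ℝ)⁻¹ := Finset.sum_image hinj
    _ = (d : ℝ)⁻¹ * ∑ m ∈ Finset.Ico ⌈Y / d⌉₊ ⌈Z / d⌉₊, (m : ℝ)⁻¹ := by
        rw [Finset.mul_sum]
        refine Finset.sum_congr rfl fun m _ => ?_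
        push_cast
        rw [mul_inv]
    _ ≤ (d : ℝ)⁻¹ * (1 + Real.log ((Z / d) / (Y / d))) := by
        gcongr
        exact sum_Ico_ceil_inv_le (div_pos hY hdR) (div_le_div_of_nonneg_right hYZ hdR.le)
    _ = (1 + Real.log (Z / Y)) / d := by
        rw [show Z / d / (Y / d) = Z / Y by field_simp]
        ring

/-- `Σ_{q ≤ X prime} 1/q² ≤ 1`. [folklore] -/
private theorem sum_primes_inv_sq_le_one (X : ℕ) :
    ∑ q ∈ (Finset.range (X + 1)).filter Nat.Prime, ((q : ℝ) ^ 2)⁻¹ ≤ 1 := by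
  have hsub : (Finset.range (X + 1)).filter Nat.Prime ⊆ Finset.Ioo 1 (X + 1) := by
    intro q hq
    rw [Finset.mem_filter, Finset.mem_range] at hq
    exact Finset.mem_Ioo.mpr ⟨hq.2.one_lt, hq.1⟩
  calc ∑ q ∈ (Finset.range (X + 1)).filter Nat.Prime, ((q : ℝ) ^ 2)⁻¹
      ≤ ∑ q ∈ Finset.Ioo 1 (X + 1), ((q : ℝ) ^ 2)⁻¹ :=
        Finset.sum_le_sum_of_subset_of_nonneg hsub fun q _ _ => by positivity
    _ ≤ 2 / (1 + 1) := by exact_mod_cast sum_Ioo_inv_sq_le (α := ℝ) 1 (X + 1)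
    _ = 1 := by norm_num

/-- **Increment moment bound**: for `c ≥ 0`, reals `1 ≤ Y ≤ Z` and any weight `g ≥ 0` with
`g(n) ≤ G` for `n ≥ Y`:
`Σ_{⌈Y⌉≤n<⌈Z⌉} n⁻¹∏_{q∣n}(1 + c/q)·g(n) ≤ eᶜ·G·(1 + log(Z/Y))` — the multiplicative-interval version
of the tree's `Sec18SjNorm.sum_prod_one_add_div_le` (expand the product over the sets `T` of prime
factors, sum along the multiples of `∏T` on `[Y,Z)` by the harmonic bound, and re-fold into
`∏_{q≤Z}(1 + c/q²) ≤ eᶜ`). It controls the weights of `S_j(𝐚₁₁,𝐚₂₁)` on the tail ranges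
`[P_k/T, P_k)` of the "simple approximation" (p. 47), where `log(Z/Y) = log T = 𝓛^{1.1}`.
[cite: Zhang2022LandauSiegel, §8 display before (8.10) p.47, tex L2436] -/
theorem sum_Ico_prod_one_add_div_mul_le {c : ℝ} (hc : 0 ≤ c) {Y Z : ℝ} (hY : 1 ≤ Y) (hYZ : Y ≤ Z)
    {g : ℕ → ℝ} {G : ℝ} (hg0 : ∀ n, 0 ≤ g n) (hg : ∀ n : ℕ, Y ≤ n → g n ≤ G) :
    ∑ n ∈ Finset.Ico ⌈Y⌉₊ ⌈Z⌉₊, (∏ q ∈ n.primeFactors, (1 + c / (q : ℝ))) / (n : ℝ) * g n ≤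
      Real.exp c * G * (1 + Real.log (Z / Y)) := by
  classical
  have hY0 : 0 < Y := by linarith
  set X : ℕ := ⌈Z⌉₊ with hX
  set P : Finset ℕ := (Finset.range (X + 1)).filter Nat.Prime with hP
  have hlog : 0 ≤ 1 + Real.log (Z / Y) := by
    have := Real.log_nonneg ((one_le_div hY0).mpr hYZ); linarith
  have hG : 0 ≤ G := le_trans (hg0 ⌈Y⌉₊) (hg _ (Nat.le_ceil Y))
  -- expand the product over subsets of the prime factors
  have hexp : ∀ n : ℕ, (∏ q ∈ n.primeFactors, (1 + c / (q : ℝ))) / (n : ℝ) * g n =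
      ∑ T ∈ n.primeFactors.powerset, (∏ q ∈ T, (c / (q : ℝ))) / (n : ℝ) * g n := by
    intro n
    rw [Finset.prod_one_add, Finset.sum_div, Finset.sum_mul]
  rw [Finset.sum_congr rfl fun n _ => hexp n]
  -- swap the sums
  have hswap : ∑ n ∈ Finset.Ico ⌈Y⌉₊ X, ∑ T ∈ n.primeFactors.powerset,
        (∏ q ∈ T, (c / (q : ℝ))) / (n : ℝ) * g n =
      ∑ T ∈ P.powerset, ∑ n ∈ (Finset.Ico ⌈Y⌉₊ X).filter (fun n => T ⊆ n.primeFactors),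
        (∏ q ∈ T, (c / (q : ℝ))) / (n : ℝ) * g n := by
    refine Finset.sum_comm' fun n T => ?_
    simp only [Finset.mem_powerset, Finset.mem_filter, Finset.mem_Ico]
    constructor
    · rintro ⟨⟨h1, h2⟩, hT⟩
      refine ⟨⟨⟨h1, h2⟩, hT⟩, hT.trans fun q hq => ?_⟩
      rw [hP, Finset.mem_filter, Finset.mem_range]
      have hq' := Nat.mem_primeFactors.mp hq
      have hn0 : 0 < n := Nat.pos_of_ne_zero hq'.2.2
      exact ⟨by have := Nat.le_of_dvd hn0 hq'.2.1; omega, hq'.1⟩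
    · rintro ⟨⟨⟨h1, h2⟩, hT⟩, _⟩
      exact ⟨⟨h1, h2⟩, hT⟩
  rw [hswap]
  -- the inner sums
  have hinner : ∀ T ∈ P.powerset,
      ∑ n ∈ (Finset.Ico ⌈Y⌉₊ X).filter (fun n => T ⊆ n.primeFactors),
          (∏ q ∈ T, (c / (q : ℝ))) / (n : ℝ) * g n ≤
        (∏ q ∈ T, (c / (q : ℝ) ^ 2)) * (G * (1 + Real.log (Z / Y))) := by
    intro T hT
    rw [Finset.mem_powerset] at hT
    have hTprime : ∀ q ∈ T, q.Prime := fun q hq => by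
      have := hT hq
      rw [hP, Finset.mem_filter] at this
      exact this.2
    set d : ℕ := ∏ q ∈ T, q with hd
    have hdpos : 0 < d := Finset.prod_pos fun q hq => (hTprime q hq).pos
    have hcT : 0 ≤ ∏ q ∈ T, (c / (q : ℝ)) := Finset.prod_nonneg fun q _ => by positivity
    have hsub : (Finset.Ico ⌈Y⌉₊ X).filter (fun n => T ⊆ n.primeFactors) ⊆
        (Finset.Ico ⌈Y⌉₊ X).filter (fun n => d ∣ n) := by
      intro n hn
      rw [Finset.mem_filter] at hn ⊢
      refine ⟨hn.1, ?_⟩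
      rw [hd]
      exact Finset.prod_primes_dvd n (fun q hq => (hTprime q hq).prime)
        fun q hq => (Nat.mem_primeFactors.mp (hn.2 hq)).2.1
    have hdR : (d : ℝ) = ∏ q ∈ T, (q : ℝ) := by rw [hd]; push_cast; rfl
    have hbound : ∀ n ∈ (Finset.Ico ⌈Y⌉₊ X).filter (fun n => T ⊆ n.primeFactors),
        (∏ q ∈ T, (c / (q : ℝ))) / (n : ℝ) * g n ≤ (∏ q ∈ T, (c / (q : ℝ))) * G * (n : ℝ)⁻¹ := by
      intro n hn
      rw [Finset.mem_filter, Finset.mem_Ico] at hn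
      have hYn : Y ≤ n := le_trans (Nat.le_ceil Y) (by exact_mod_cast hn.1.1)
      rw [div_eq_mul_inv, mul_assoc, mul_assoc]
      apply mul_le_mul_of_nonneg_left _ hcT
      rw [mul_comm]
      exact mul_le_mul_of_nonneg_right (hg n hYn) (by positivity)
    calc ∑ n ∈ (Finset.Ico ⌈Y⌉₊ X).filter (fun n => T ⊆ n.primeFactors),
          (∏ q ∈ T, (c / (q : ℝ))) / (n : ℝ) * g n
        ≤ ∑ n ∈ (Finset.Ico ⌈Y⌉₊ X).filter (fun n => T ⊆ n.primeFactors),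
            (∏ q ∈ T, (c / (q : ℝ))) * G * (n : ℝ)⁻¹ := Finset.sum_le_sum hbound
      _ = (∏ q ∈ T, (c / (q : ℝ))) * G *
            ∑ n ∈ (Finset.Ico ⌈Y⌉₊ X).filter (fun n => T ⊆ n.primeFactors), (n : ℝ)⁻¹ := by
          rw [Finset.mul_sum]
      _ ≤ (∏ q ∈ T, (c / (q : ℝ))) * G *
            ∑ n ∈ (Finset.Ico ⌈Y⌉₊ X).filter (fun n => d ∣ n), (n : ℝ)⁻¹ :=
          mul_le_mul_of_nonneg_left
            (Finset.sum_le_sum_of_subset_of_nonneg hsub fun n _ _ => by positivity)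
            (mul_nonneg hcT hG)
      _ ≤ (∏ q ∈ T, (c / (q : ℝ))) * G * ((1 + Real.log (Z / Y)) / d) := by
          apply mul_le_mul_of_nonneg_left _ (mul_nonneg hcT hG)
          rw [hX]
          exact sum_inv_filter_dvd_Ico_le hdpos hY0 hYZ
      _ = (∏ q ∈ T, (c / (q : ℝ))) / (∏ q ∈ T, (q : ℝ)) * (G * (1 + Real.log (Z / Y))) := by
          rw [hdR]; ring
      _ = (∏ q ∈ T, (c / (q : ℝ) ^ 2)) * (G * (1 + Real.log (Z / Y))) := by
          rw [← Finset.prod_div_distrib]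
          congr 1
          refine Finset.prod_congr rfl fun q _ => ?_
          rw [div_div, sq]
  -- re-fold and bound the Euler-type product
  calc ∑ T ∈ P.powerset, ∑ n ∈ (Finset.Ico ⌈Y⌉₊ X).filter (fun n => T ⊆ n.primeFactors),
          (∏ q ∈ T, (c / (q : ℝ))) / (n : ℝ) * g n
      ≤ ∑ T ∈ P.powerset, (∏ q ∈ T, (c / (q : ℝ) ^ 2)) * (G * (1 + Real.log (Z / Y))) :=
        Finset.sum_le_sum hinner
    _ = (∏ q ∈ P, (1 + c / (q : ℝ) ^ 2)) * (G * (1 + Real.log (Z / Y))) := by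
        rw [← Finset.sum_mul, Finset.prod_one_add]
    _ ≤ Real.exp (∑ q ∈ P, c / (q : ℝ) ^ 2) * (G * (1 + Real.log (Z / Y))) := by
        apply mul_le_mul_of_nonneg_right _ (mul_nonneg hG hlog)
        exact Real.prod_one_add_le_exp_sum P fun q => by positivity
    _ ≤ Real.exp c * (G * (1 + Real.log (Z / Y))) := by
        apply mul_le_mul_of_nonneg_right _ (mul_nonneg hG hlog)
        apply Real.exp_le_exp.mpr
        calc ∑ q ∈ P, c / (q : ℝ) ^ 2 = c * ∑ q ∈ P, ((q : ℝ) ^ 2)⁻¹ := by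
              rw [Finset.mul_sum]
              refine Finset.sum_congr rfl fun q _ => ?_
              rw [div_eq_mul_inv]
          _ ≤ c * 1 := by
              apply mul_le_mul_of_nonneg_left _ hc
              rw [hP]; exact sum_primes_inv_sq_le_one X
          _ = c := mul_one c
    _ = Real.exp c * G * (1 + Real.log (Z / Y)) := by ring

end Literature.NumberTheory.LFunctions.Zhang2022.Section8FrontEnd44Moments
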